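import Summits.QuantumFields.YangMills.Theorems.BalabanUVNodesN19RekeyingAscent
import Summits.QuantumFields.YangMills.Theorems.BalabanUVNodesN19RekeyingCalculusPathLeaf

/-!
# BalabanUVNodes ∕ node N19 (NE7) — THE RE-KEYING CALCULUS, PART III: the price of ascent is ADDITIVE ALONG A TOWER of class keys, and the H1L
# shape `PathLeaf` ascends at the same price

Cell `pub-ymgap` (HUMAN RULING D-0062 Track A ∕ D-0149 width seats), WIDTH SEAT `pub-ymgap-dag-n19-w1` (node n19 = NE7, seat 1 of 3), generation g3,
INTENT-4.  Route `Summits/QuantumFields/YangMills/Theses/BalabanUVNodes.lean`, key item K3⁷ `SpineGivenEndpointR13SepCoPH` (stmt-QuantumFields-20544); filed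
`--kind proof --supports … --as helper`.  COUNT-NEUTRAL.  THEOREMS ONLY (0 `def`, 0 `sorry`).  ADDITIVE — imports this seat's g3 `…N19RekeyingAscent` (INTENT-1:
`core_of_core_classVal`) and g2 `…N19RekeyingCalculusPathLeaf` (p595824∕p599047: `pathLeaf_of_core`, `pos_of_pathLeaf`; through them Part I `…N19RekeyingCalculus`:
`classVal_comp`, `classVal_nonneg`; `Spine/NE7/Targets`: `Core`, `PathLeaf`, `core_of_pathLeaf`; dag-n19-e `…N19CoreMetric`: `core_congr`, `core_of_subset`) — CITED BY NAME.

WHY.  The reading's class key at the ₁₃ record is a TOWER: a term of dag-n20-d's `crOfRecord₁₃VAt` is a `(K₀ + K + 1)`-history classed by prefixes, and every prefix length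
is a coarser key (Part I: `classVal_comp` — re-keying twice is re-keying by the composite).  Part II priced ONE ascent step: coarse `Core δ` + the fibrewise letter `Fib(ε)` ⇒
fine `Core (δ + 2ε)`.  This file records that the price is ADDITIVE along the tower and that nothing else accumulates:
* §1 [folklore] `classVal_congr_map` (fibre sums depend on the class map only through its values on `S K`) · ★★ `core_of_core_classVal_comp` — TWO STEPS `σ →π κ →ρ ι`:
  `Core δ` at the coarsest key `ι` (families `classVal S (ρ ∘ π)`), `Fib_ρ(ε₁)` for the middle families `classVal S π` on the fibres of `ρ` over the good `ι`-classes, and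
  `Fib_π(ε₂)` for the fine families on the fibres of `π` over the good `κ`-classes (good = NOT in the pull-back of `Bad`) ⇒ `Core (δ + 2ε₁ + 2ε₂)` at the fine key with bad
  class the pull-back along `ρ ∘ π` — Part II twice, glued by `classVal_comp`; by induction any finite tower pays `δ + 2·Σ_j ε_j` · `coreEdge_of_coreEdge_classVal_comp`.
* §2 [folklore] ★ `pathLeaf_of_pathLeaf_classVal` — THE H1L SHAPE ASCENDS AT THE SAME PRICE: coarse `PathLeaf δ` (for the fibre sums) + `Fib(ε)` + positive fine cores on the
  pull-back-good classes ⇒ fine `PathLeaf (δ + 2ε)` (g2: `PathLeaf ⟺ Core ∧ positivity`; Part II's `core_of_core_classVal` in between) · `pathLeaf_of_pathLeaf_classVal_comp`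
  (two steps).
READING (for the planner; located, nothing proposed).  Along the history tower of the reading of record the N19′ slot at prefix length `n` costs the slot at length `0`
(at the extreme: node U5's DECL target) plus `2·Σ_{j<n} ε^{(j)}_K`, one constant-free homogeneity letter per prefix step; summability over `K` of that SUM is the budget a
closing proof at the full key must meet (with `n = K₀ + K + 1` steps at level `K`, per-step letters uniform in `j` do NOT suffice — they must decay in the scale gap, the
shape of node U6's `T4CauchySum.InjectedRate` ∕ `delta`), whereas a proof content with a SHORTER key pays fewer letters (Part I: descent is free).  The choice of `n` — how
much history the class key of the spine reading retains — is therefore a genuine dial of the line, currently fixed (not read per tuple) by `crOfRecord₁₃V`.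

HONEST FRAMING.  Finite-sum bookkeeping [folklore] over the tree's SHAPES; `Fib`, `Core`, `PathLeaf` occur as HYPOTHESES only; nothing of Bałaban's is asserted or instantiated;
no estimate of the programme is proved.  NE7 NOT PRINTED as a two-run statement for d = 4 ∕ NOT proved; N19 NOT discharged (0∕1); K3⁷ OPEN, not claimed; counts UNMOVED (typed
28∕28 · discharged 5∕27, A 5∕28).  Everything below is PROVED (0 `sorry`, 0 named facts, standard axioms); no decl carries a cite tag.  One finite four-torus programme at
fixed ε — NOT ℝ⁴, NOT infinite volume, NOT OS, NOT a mass gap, NOT the Clay problem (R4 closes the conditional finite-𝕋⁴ rung `BalabanLadder.UV` only).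
-/

noncomputable section

namespace Summit.QuantumFields.YangMills.BalabanUVNodes.N19RekeyingAscentTower

open Finset
open Summit.QuantumFields.BalabanUV.T4Continuum.Spine.NE7 (Core PathLeaf core_of_pathLeaf)
open Literature.MathematicalPhysics.QuantumFieldTheory.Balaban1983to89
open T4MatchingAssembly (classVal classVal_nonneg)
open Summit.QuantumFields.YangMills.BalabanUVNodes.N19RekeyingCalculus (classVal_apply classVal_comp pathLeaf_of_core)
open Summit.QuantumFields.YangMills.BalabanUVNodes.N19RekeyingAscent (core_of_core_classVal)
open Summit.QuantumFields.YangMills.BalabanUVNodes.N19CoreMetric (core_congr core_of_subset)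

variable {σ κ ι : Type*} [DecidableEq σ] [DecidableEq κ] [DecidableEq ι]

/-! ## §1 Two ascent steps compose with additive price [folklore] -/

section Tower
variable {l₀ vol : ℝ} {S : ℕ → Finset σ} {U : ℕ → Finset κ} {T : ℕ → Finset ι} {π : ℕ → σ → κ} {ρ : ℕ → κ → ι}
  {p q : ℕ → ℝ → σ → ℝ} {Bad : ℕ → ℝ → Finset ι} {δ ε₁ ε₂ : ℕ → ℝ}

omit [DecidableEq σ] in
/-- Fibre sums depend on the class map only through its values on `S K`. [folklore] -/
theorem classVal_congr_map {π₁ π₂ : ℕ → σ → κ} (h : ∀ K, ∀ s ∈ S K, π₁ K s = π₂ K s) (a : ℕ → ℝ → σ → ℝ) (K : ℕ) (t : ℝ) (u : κ) :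
    classVal S π₁ a K t u = classVal S π₂ a K t u := by
  rw [classVal_apply, classVal_apply]
  exact Finset.sum_congr (Finset.filter_congr fun s hs => by rw [h K s hs]) fun _ _ => rfl

/-- **★★ TWO ASCENT STEPS `σ →π κ →ρ ι` COMPOSE, THE PRICE ADDS** [folklore].  Coarsest `Core δ` for the composite fibre sums `classVal S (ρ ∘ π) p ∕ q` at `(T, Bad)`; the
fibrewise letter `Fib_ρ(ε₁)` for the middle families `classVal S π p ∕ q` on the fibres of `ρ K` in `U K` over the good `ι`-classes; the fibrewise letter `Fib_π(ε₂)` for the fine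
families on the fibres of `π K` in `S K` over the `κ`-classes OUTSIDE the pull-back of `Bad` along `ρ`; `π K : S K → U K`, `ρ K : U K → T K`, `p ≥ 0` ⇒ fine
`Core (δ + 2ε₁ + 2ε₂)` at the pull-back of `Bad` along `ρ ∘ π`, with the COARSEST constants.  (Part II's `core_of_core_classVal` twice; Part I's `classVal_comp` identifies the
middle step's coarse data; the two pull-backs compose.)  By induction a finite tower pays `δ + 2·Σ_j ε_j`. -/
theorem core_of_core_classVal_comp (hπ : ∀ K, ∀ s ∈ S K, π K s ∈ U K) (hρ : ∀ K, ∀ u ∈ U K, ρ K u ∈ T K)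
    (hp : ∀ (K : ℕ) (t : ℝ), |t| ≤ l₀ → ∀ s ∈ S K, 0 ≤ p K t s)
    (hC : Core l₀ vol T Bad (classVal S (fun K s => ρ K (π K s)) p) (classVal S (fun K s => ρ K (π K s)) q) δ)
    (hF₁ : ∀ (K : ℕ) (t : ℝ), |t| ≤ l₀ → ∀ τ ∈ T K \ Bad K t, ∃ r : ℝ, ∀ u ∈ (U K).filter (fun u => ρ K u = τ),
      Real.exp (r - vol * ε₁ K) * classVal S π p K t u ≤ classVal S π q K t u ∧ classVal S π q K t u ≤ Real.exp (r + vol * ε₁ K) * classVal S π p K t u)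
    (hF₂ : ∀ (K : ℕ) (t : ℝ), |t| ≤ l₀ → ∀ u ∈ U K \ (U K).filter (fun u => ρ K u ∈ Bad K t), ∃ r : ℝ, ∀ s ∈ (S K).filter (fun s => π K s = u),
      Real.exp (r - vol * ε₂ K) * p K t s ≤ q K t s ∧ q K t s ≤ Real.exp (r + vol * ε₂ K) * p K t s) :
    Core l₀ vol S (fun K t => (S K).filter fun s => ρ K (π K s) ∈ Bad K t) p q (fun K => δ K + 2 * ε₁ K + 2 * ε₂ K) := by
  -- the coarsest data ARE the ρ-fibre sums of the middle families
  have hC' : Core l₀ vol T Bad (classVal U ρ (classVal S π p)) (classVal U ρ (classVal S π q)) δ :=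
    core_congr (fun K t _ τ _ => classVal_comp ρ hπ K t τ) (fun K t _ τ _ => classVal_comp ρ hπ K t τ) hC
  -- step 1: ascend ι → κ
  have hmid : Core l₀ vol U (fun K t => (U K).filter fun u => ρ K u ∈ Bad K t) (classVal S π p) (classVal S π q) (fun K => δ K + 2 * ε₁ K) :=
    core_of_core_classVal hρ (fun K t ht u _ => classVal_nonneg (hp K t ht) u) hC' hF₁
  -- step 2: ascend κ → σ
  have hfine := core_of_core_classVal (Bad := fun K t => (U K).filter fun u => ρ K u ∈ Bad K t) hπ hp hmid hF₂
  -- the two pull-backs compose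
  refine core_of_subset le_rfl (fun K t _ s hs => ?_) hfine
  obtain ⟨hsS, hsB⟩ := Finset.mem_sdiff.mp hs
  exact Finset.mem_sdiff.mpr ⟨hsS, fun hb => hsB (Finset.mem_filter.mpr ⟨hsS, (Finset.mem_filter.mp (Finset.mem_filter.mp hb).2).2⟩)⟩

/-- The edge form of the two-step ascent: the coarsest edge `∃ δ, Core ∧ Summable δ` and SUMMABLE letters `Fib_ρ`, `Fib_π` give the fine edge at the composite pull-back. [folklore] -/
theorem coreEdge_of_coreEdge_classVal_comp (hπ : ∀ K, ∀ s ∈ S K, π K s ∈ U K) (hρ : ∀ K, ∀ u ∈ U K, ρ K u ∈ T K)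
    (hp : ∀ (K : ℕ) (t : ℝ), |t| ≤ l₀ → ∀ s ∈ S K, 0 ≤ p K t s)
    (hC : ∃ δ : ℕ → ℝ, Core l₀ vol T Bad (classVal S (fun K s => ρ K (π K s)) p) (classVal S (fun K s => ρ K (π K s)) q) δ ∧ Summable δ)
    (hF₁ : ∃ ε₁ : ℕ → ℝ, (∀ (K : ℕ) (t : ℝ), |t| ≤ l₀ → ∀ τ ∈ T K \ Bad K t, ∃ r : ℝ, ∀ u ∈ (U K).filter (fun u => ρ K u = τ),
      Real.exp (r - vol * ε₁ K) * classVal S π p K t u ≤ classVal S π q K t u ∧ classVal S π q K t u ≤ Real.exp (r + vol * ε₁ K) * classVal S π p K t u) ∧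
      Summable ε₁)
    (hF₂ : ∃ ε₂ : ℕ → ℝ, (∀ (K : ℕ) (t : ℝ), |t| ≤ l₀ → ∀ u ∈ U K \ (U K).filter (fun u => ρ K u ∈ Bad K t), ∃ r : ℝ, ∀ s ∈ (S K).filter (fun s => π K s = u),
      Real.exp (r - vol * ε₂ K) * p K t s ≤ q K t s ∧ q K t s ≤ Real.exp (r + vol * ε₂ K) * p K t s) ∧ Summable ε₂) :
    ∃ δ : ℕ → ℝ, Core l₀ vol S (fun K t => (S K).filter fun s => ρ K (π K s) ∈ Bad K t) p q δ ∧ Summable δ := by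
  obtain ⟨δ, hC, hδ⟩ := hC
  obtain ⟨ε₁, hF₁, hε₁⟩ := hF₁
  obtain ⟨ε₂, hF₂, hε₂⟩ := hF₂
  exact ⟨_, core_of_core_classVal_comp hπ hρ hp hC hF₁ hF₂, (hδ.add (hε₁.mul_left 2)).add (hε₂.mul_left 2)⟩

end Tower

/-! ## §2 The H1L shape `PathLeaf` ascends at the same price [folklore] -/

section PathLeafAscent
variable {l₀ vol : ℝ} {S : ℕ → Finset σ} {U : ℕ → Finset κ} {T : ℕ → Finset ι} {π : ℕ → σ → κ} {ρ : ℕ → κ → ι} {πι : ℕ → σ → ι}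
  {p q : ℕ → ℝ → σ → ℝ} {Bad : ℕ → ℝ → Finset ι} {δ ε ε₁ ε₂ : ℕ → ℝ}

/-- **★ `PathLeaf` ASCENDS** [folklore].  The H1L route's output for the FIBRE SUMS at the coarse key (`PathLeaf δ`: per good coarse class a positive `C¹` path from run A's to run
B's class value with log-derivative within `vol·δ_K` of one drift), the fibrewise letter `Fib(ε)`, `p ≥ 0`, and POSITIVE fine cores on the pull-back-good fine classes ⇒ fine
`PathLeaf (δ + 2ε)` — g2's `PathLeaf ⟺ Core ∧ positivity` around Part II's `core_of_core_classVal`.  (The ascended path is the straight one of `pathLeaf_of_core`; the coarse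
paths themselves are not lifted — only their endpoints' sandwich is.) -/
theorem pathLeaf_of_pathLeaf_classVal (hmaps : ∀ K, ∀ s ∈ S K, πι K s ∈ T K) (hp0 : ∀ (K : ℕ) (t : ℝ), |t| ≤ l₀ → ∀ s ∈ S K, 0 ≤ p K t s)
    (hL : PathLeaf l₀ vol T Bad (classVal S πι p) (classVal S πι q) δ)
    (hF : ∀ (K : ℕ) (t : ℝ), |t| ≤ l₀ → ∀ τ ∈ T K \ Bad K t, ∃ r : ℝ, ∀ s ∈ (S K).filter (fun s => πι K s = τ),
      Real.exp (r - vol * ε K) * p K t s ≤ q K t s ∧ q K t s ≤ Real.exp (r + vol * ε K) * p K t s)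
    (hp : ∀ (K : ℕ) (t : ℝ), |t| ≤ l₀ → ∀ s ∈ S K \ (S K).filter (fun s => πι K s ∈ Bad K t), 0 < p K t s)
    (hq : ∀ (K : ℕ) (t : ℝ), |t| ≤ l₀ → ∀ s ∈ S K \ (S K).filter (fun s => πι K s ∈ Bad K t), 0 < q K t s) :
    PathLeaf l₀ vol S (fun K t => (S K).filter fun s => πι K s ∈ Bad K t) p q (fun K => δ K + 2 * ε K) :=
  pathLeaf_of_core (core_of_core_classVal hmaps hp0 (core_of_pathLeaf hL) hF) hp hq

/-- `PathLeaf` along two steps: coarsest `PathLeaf δ` + `Fib_ρ(ε₁)` + `Fib_π(ε₂)` + positive fine cores ⇒ fine `PathLeaf (δ + 2ε₁ + 2ε₂)` (§1 inside). [folklore] -/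
theorem pathLeaf_of_pathLeaf_classVal_comp (hπ : ∀ K, ∀ s ∈ S K, π K s ∈ U K) (hρ : ∀ K, ∀ u ∈ U K, ρ K u ∈ T K)
    (hp0 : ∀ (K : ℕ) (t : ℝ), |t| ≤ l₀ → ∀ s ∈ S K, 0 ≤ p K t s)
    (hL : PathLeaf l₀ vol T Bad (classVal S (fun K s => ρ K (π K s)) p) (classVal S (fun K s => ρ K (π K s)) q) δ)
    (hF₁ : ∀ (K : ℕ) (t : ℝ), |t| ≤ l₀ → ∀ τ ∈ T K \ Bad K t, ∃ r : ℝ, ∀ u ∈ (U K).filter (fun u => ρ K u = τ),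
      Real.exp (r - vol * ε₁ K) * classVal S π p K t u ≤ classVal S π q K t u ∧ classVal S π q K t u ≤ Real.exp (r + vol * ε₁ K) * classVal S π p K t u)
    (hF₂ : ∀ (K : ℕ) (t : ℝ), |t| ≤ l₀ → ∀ u ∈ U K \ (U K).filter (fun u => ρ K u ∈ Bad K t), ∃ r : ℝ, ∀ s ∈ (S K).filter (fun s => π K s = u),
      Real.exp (r - vol * ε₂ K) * p K t s ≤ q K t s ∧ q K t s ≤ Real.exp (r + vol * ε₂ K) * p K t s)
    (hp : ∀ (K : ℕ) (t : ℝ), |t| ≤ l₀ → ∀ s ∈ S K \ (S K).filter (fun s => ρ K (π K s) ∈ Bad K t), 0 < p K t s)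
    (hq : ∀ (K : ℕ) (t : ℝ), |t| ≤ l₀ → ∀ s ∈ S K \ (S K).filter (fun s => ρ K (π K s) ∈ Bad K t), 0 < q K t s) :
    PathLeaf l₀ vol S (fun K t => (S K).filter fun s => ρ K (π K s) ∈ Bad K t) p q (fun K => δ K + 2 * ε₁ K + 2 * ε₂ K) :=
  pathLeaf_of_core (core_of_core_classVal_comp hπ hρ hp0 (core_of_pathLeaf hL) hF₁ hF₂) hp hq

end PathLeafAscent

end Summit.QuantumFields.YangMills.BalabanUVNodes.N19RekeyingAscentTower

end
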